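import Summits.QuantumFields.QCD.Theorems.QuarksAsStableActionStableActionBridgeDefs
import Summits.QuantumFields.QCD.Theorems.GapBuysCauchyRateConvergentOSClosureStubAsymptoticTranslation
import Literature.MathematicalPhysics.QuantumFieldTheory.QCDTorusTranslation
import HarnessLib

/-!
# Stub `stub_onePointFactorisation` (T1 of line `registered`, reshape r2, crux stmt-QuantumFields-8840
`RotationRestoration`) — PROVED

**One-point factorisation on the lattice.**  At every cutoff `k` and for every species string `σ : Fin 1 → _`
the honest lattice one-point function of lattice QCD is a `k`-dependent constant times the Riemann sum of the
test function: `qcdLatticeSchwinger sch k 1 σ f = w · a_k⁴ ∑_{x ∈ box_k} f(a_k x)`.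

Proof (pure lattice bookkeeping, everything landed):
* on a tensor witness `F` of `f` (`exists_isTensorOf`) the degree-one lattice Schwinger function is the finite
  atomic distribution `qcdLatticeDist` (`StableActionBridge.Sketch.qcdLatticeSchwinger_eq_qcdLatticeDist`,
  `qcdLatticeDist_apply`): `∑_{x ∈ box} W_σ(x) f(a_k x)` with the weight `W_σ(x) = qcdTorusMomentStr sch k σ x`,
  the honest expectation of the renormalised centred insertion at `x`;
* the weights are invariant under the simultaneous shift of all insertion sites
  (`ConvergentOSClosure.qcdTorusMomentStr_add_const`, from the translation covariance of the honest signed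
  torus functional `qcdTorusExpect_quarkTranslate`), and in degree one every site tuple is a shift of the origin,
  so `W_σ(x) = W_σ(0)`;
* `w := W_σ(0) / a_k⁴` (`a_k > 0`); the junk case of a vanishing fermionic partition function is covered because
  `W_σ(0)` is defined through the same quotient.
References: Osterwalder–Seiler 1978 §2; Montvay–Münster 1994 §4.1, §5.1.
-/

noncomputable section

namespace Summit.QuantumFields.QCD.Cruxes.RotationRestoration.Birth

open scoped BigOperators Topology SchwartzMap
open Filter
open Literature.MathematicalPhysics.QuantumLattice Literature.MathematicalPhysics.AQFT
  Literature.MathematicalPhysics.QuantumFieldTheory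
open Literature.Probability.LatticeModels (box)

namespace OnePointFactorisation

open Summit.QuantumFields.QCD.Cruxes.StableActionBridge.Sketch
open Summit.QuantumFields.QCD.Theorems.ConvergentOSClosure (qcdTorusMomentStr_add_const)

variable {Nf : ℕ}

/-- **Degree-one weights do not depend on the site**: `W_σ(x) = W_σ(0)` for `x : Fin 1 → ℤ⁴` — every
one-tuple is the simultaneous shift of the origin by `x 0`, and the weights are invariant under simultaneous
shifts (`qcdTorusMomentStr_add_const`). -/
theorem qcdTorusMomentStr_fin_one (sch : QCDScheme Nf) (k : ℕ) (σ : Fin 1 → QCDField Nf)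
    (x : Fin 1 → Literature.Probability.LatticeModels.Site 4) :
    qcdTorusMomentStr sch k σ x = qcdTorusMomentStr sch k σ (fun _ => 0) := by
  have hx : x = fun i => (fun _ : Fin 1 => (0 : Literature.Probability.LatticeModels.Site 4)) i + x 0 := by
    funext i
    rw [Subsingleton.elim i 0, zero_add]
  rw [hx, qcdTorusMomentStr_add_const]

/-- **The degree-one lattice Schwinger function is `W_σ(0)` times the (unnormalised) Riemann sum**:
`qcdLatticeSchwinger sch k 1 σ f = W_σ(0) · ∑_{x ∈ box_k} f(a_k x)`. -/
theorem qcdLatticeSchwinger_one_eq (sch : QCDScheme Nf) (k : ℕ) (σ : Fin 1 → QCDField Nf)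
    (f : Fin 1 → 𝓢(EuclideanSpace ℝ (Fin 4), ℝ)) :
    qcdLatticeSchwinger sch k 1 σ f =
      qcdTorusMomentStr sch k σ (fun _ => 0) *
        ∑ x ∈ box 4 (sch.L k), ((f 0 (sch.a k • siteToE x) : ℝ) : ℂ) := by
  classical
  obtain ⟨F, hF⟩ := exists_isTensorOf (fun i => ofRealTest (f i))
  rw [← qcdLatticeSchwinger_eq_qcdLatticeDist sch k 1 one_ne_zero σ f F hF,
    qcdLatticeDist_apply sch k one_ne_zero σ F, Finset.mul_sum]
  refine Finset.sum_nbij' (fun x => x 0) (fun y _ => y) (fun x hx => Fintype.mem_piFinset.1 hx 0)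
    (fun y hy => Fintype.mem_piFinset.2 fun _ => hy) (fun x _ => funext fun i => ?_) (fun y _ => rfl)
    fun x _ => ?_
  · rw [Subsingleton.elim i 0]
  · rw [qcdTorusMomentStr_fin_one sch k σ x, hF]
    simp only [Fin.prod_univ_one, ofRealTest_apply]

end OnePointFactorisation

/-- **Registered stub `stub_onePointFactorisation` (T1) — one-point factorisation on the lattice (PROVED).**
At every cutoff `k` and for every species `σ 0`, the lattice one-point function is a `k`-dependent constant
times the Riemann sum of the test function: `⟨Φ^{s}_k(f)⟩ = w_k(s) · a_k⁴ ∑_{x ∈ box_k} f(a_k x)`, with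
`w_k(s) = W_σ(0) / a_k⁴` (`OnePointFactorisation.qcdLatticeSchwinger_one_eq`, translation invariance of the
weights `OnePointFactorisation.qcdTorusMomentStr_fin_one`). -/
theorem stub_onePointFactorisation :
    ∀ (Nf : ℕ) (sch : QCDScheme Nf) (k : ℕ) (σ : Fin 1 → QCDField Nf), ∃ w : ℂ,
      ∀ f : Fin 1 → 𝓢(EuclideanSpace ℝ (Fin 4), ℝ),
        qcdLatticeSchwinger sch k 1 σ f =
          w * ((sch.a k ^ 4 * ∑ x ∈ box 4 (sch.L k), f 0 (sch.a k • siteToE x) : ℝ) : ℂ) := by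
  intro Nf sch k σ
  refine ⟨Summit.QuantumFields.QCD.Cruxes.StableActionBridge.Sketch.qcdTorusMomentStr sch k σ (fun _ => 0) /
    ((sch.a k ^ 4 : ℝ) : ℂ), fun f => ?_⟩
  have hA : ((sch.a k ^ 4 : ℝ) : ℂ) ≠ 0 := Complex.ofReal_ne_zero.2 (pow_pos (sch.a_pos k) 4).ne'
  rw [OnePointFactorisation.qcdLatticeSchwinger_one_eq, Complex.ofReal_mul, Complex.ofReal_sum, ← mul_assoc,
    div_mul_cancel₀ _ hA]

end Summit.QuantumFields.QCD.Cruxes.RotationRestoration.Birth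

end
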